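import Summits.NavierStokesRegularity.FluidComputer.HeadStartPulseDouse

/-!
# The head-start gate under a POLYNOMIAL amplitude threshold, part 3: (toke), delivery, the free aftermath

Companion of `HeadStartPulse{Fire,Douse}.lean` (cell `pub-fluidc`, blueprint seat bp1, gen 20; ONE text split
by the 400-line rule; namespace `Summit.NavierStokesRegularity.FluidComputer.HeadStart`). HONEST FRAMING
(verbatim): low prior, high value-of-information experiment on Tao's machine paradigm; NOT a claim that NS
blows up. Five-mode truncation (5.5) of [Tao2016AveragedNS, §5.5] in the retuned form
`delayCircuitWith K M ε` with a diagonal damping `-E(t) * X(t)`, `0 ≤ Eᵢ(t) ≤ η ≤ 1/100`, on `[0,2]`, from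
the signed head-start class `HS±(ε)`; nothing is proved about Navier–Stokes. Under the PULSE HYPOTHESIS
(hεT) `64·M·ε²·e^{5M(T - t_c)} ≤ K²⁰` of part 1 on a horizon `T ≤ 2`:
* `KVe_small_on`, `Es_decay_on` — (toke) in TIME-RESOLVED form on `[t', T]`, `t' = t_c + δ + 1/K`:
  `E_*(t) ≤ e^{-(K/10)(t - t')} + 70K⁻⁹⁰` (`HeadStart.Es_decay` evaluates this at `t ≥ t' + 1/√K - 1/K`);
* `sum_sq_on` — DELIVERY: for a drain time `L ≥ 0` with (N4') `2e^{-KL/10} ≤ K⁻²⁰`,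
  `a² + b² + c² + d² ≤ 142K⁻²⁰` on `[t' + L, T]`;
* `sumFour_antitoneOn` — `a² + b² + c² + d²` is non-increasing on `[0,2]` under ANY non-negative diagonal
  damping (`∂ₜ = -2Kd²ã - 2Σ_{i<4} EᵢXᵢ²`, `ã ≥ 0`): the four gates among `a, b, c, d` are conservative and
  energy only leaves through the pump `d ⇒ ã`; hence `sum_sq_from`: once delivered at `T₀ = t' + L ≤ T`,
  the bound `142K⁻²⁰` persists on `[T₀, 2]` with NO hypothesis bearing on times after `T`.
[cite: Tao2016AveragedNS, §5.5 Thm 5.3 proof: (toke), (beable), (energy-con)]. No named facts; 0 sorry.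
-/

noncomputable section

namespace Summit.NavierStokesRegularity.FluidComputer

open Real Set Filter Topology
open Literature.Analysis.FluidPDE.Tao2016AveragedNS
open Literature.Analysis.FluidPDE.Tao2016AveragedNS.Thm53 (antitoneOn_intFactor invSqrt_facts decay_alg)
open DampedTransition (hasDerivAt_a hasDerivAt_b hasDerivAt_c hasDerivAt_d hasDerivAt_e hasDerivAt_Es)

namespace HeadStart

variable {K M ε η τ δ T L : ℝ} {E X : ℝ → Fin 5 → ℝ}

/-- On `[t_c + δ, T]`: `|½K·V·ã| ≤ ½K⁻⁹⁹` (`V = adε²/c`, `ε²/c ≤ K⁻¹⁰⁰`).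
[cite: Tao2016AveragedNS, §5.5 (proof of (beable))] -/
theorem KVe_small_on
    (hX : ∀ t ∈ Icc (0:ℝ) 2, HasDerivAt X (delayCircuitWith K M ε (X t) - E t * X t) t)
    (hE : ∀ t ∈ Icc (0:ℝ) 2, ∀ i, 0 ≤ E t i ∧ E t i ≤ η)
    (h0 : X 0 0 ^ 2 + X 0 1 ^ 2 = 1 ∧ 0 ≤ X 0 0 ∧ -(1 / 5 * ε) ≤ X 0 1 ∧ X 0 1 ≤ 2 / 5 * ε ∧ X 0 2 = 0 ∧ X 0 3 = 0 ∧ X 0 4 = 0)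
    (hε : 0 < ε) (hε1 : ε ≤ 1) (hM0 : 0 < M) (hMK : M ≤ K ^ 10) (hK : 16 ≤ K) (hεK : ε ^ 2 ≤ 1 / (12 * K ^ 20))
    (hKM : exp (-M) ≤ 1 / K ^ 10) (hη : η ≤ 1 / 100)
    (hδ : 0 ≤ δ) (hon : K ^ 111 ≤ exp (M * δ / 8))
    (hτ1 : 1 ≤ τ) (hτT : τ ≤ T) (hT2 : T ≤ 2)
    (hεT : 64 * M * ε ^ 2 * exp (5 * M * (T - τ)) ≤ K ^ 20)
    (hcτ : ∀ t, 0 ≤ t → t ≤ τ → X t 2 ≤ ε ^ 2 / K ^ 10) (hcτeq : X τ 2 = ε ^ 2 / K ^ 10)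
    {s : ℝ} (hs : s ∈ Icc (τ + δ) T) :
    |K / 2 * (X s 0 * X s 3 * (ε ^ 2 * (X s 2)⁻¹) * X s 4)| ≤ 1 / 2 / K ^ 99 := by
  have hK0 : 0 < K := by linarith
  have hs02 : s ∈ Icc (0 : ℝ) 2 := ⟨by linarith [hs.1], hs.2.trans hT2⟩
  have hcl : K ^ 100 * ε ^ 2 ≤ X s 2 :=
    c_large_on hX hE h0 hε hε1 hM0 hMK hK hεK hKM hη hδ hon hτ1 hτT hT2 hεT hcτ hcτeq hs
  have hcpos : 0 < X s 2 := lt_of_lt_of_le (by positivity) hcl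
  have hq0 : 0 ≤ ε ^ 2 * (X s 2)⁻¹ := by positivity
  have hq : ε ^ 2 * (X s 2)⁻¹ ≤ 1 / K ^ 100 := by
    rw [← div_eq_mul_inv, div_le_div_iff₀ hcpos (by positivity), one_mul]; linarith
  rw [abs_mul, abs_of_pos (by positivity : 0 < K / 2), abs_mul, abs_mul, abs_mul,
    abs_of_nonneg hq0]
  calc K / 2 * (|X s 0| * |X s 3| * (ε ^ 2 * (X s 2)⁻¹) * |X s 4|)
      ≤ K / 2 * (1 * 1 * (1 / K ^ 100) * 1) := by
        refine mul_le_mul_of_nonneg_left ?_ (by positivity)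
        exact mul_le_mul (mul_le_mul (mul_le_mul (traj_abs_le_one hX hE h0 hs02 0)
          (traj_abs_le_one hX hE h0 hs02 3) (abs_nonneg _) zero_le_one) hq hq0 (by norm_num))
          (traj_abs_le_one hX hE h0 hs02 4) (abs_nonneg _) (by positivity)
    _ = 1 / 2 / K ^ 99 := by field_simp

/-- **(toke), time-resolved**: Grönwall for `E_*` at the constant rate `K/10` from `t' = t_c + δ + 1/K` on
`[t', T]`: `E_*(t) ≤ e^{(K/10)(t' - t)}·1 + 70K⁻⁹⁰`. [cite: Tao2016AveragedNS, §5.5 (toke)] -/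
theorem Es_decay_on
    (hX : ∀ t ∈ Icc (0:ℝ) 2, HasDerivAt X (delayCircuitWith K M ε (X t) - E t * X t) t)
    (hE : ∀ t ∈ Icc (0:ℝ) 2, ∀ i, 0 ≤ E t i ∧ E t i ≤ η)
    (h0 : X 0 0 ^ 2 + X 0 1 ^ 2 = 1 ∧ 0 ≤ X 0 0 ∧ -(1 / 5 * ε) ≤ X 0 1 ∧ X 0 1 ≤ 2 / 5 * ε ∧ X 0 2 = 0 ∧ X 0 3 = 0 ∧ X 0 4 = 0)
    (hε : 0 < ε) (hε1 : ε ≤ 1) (hM0 : 0 < M) (hMK : M ≤ K ^ 10) (hK : 16 ≤ K) (hεK : ε ^ 2 ≤ 1 / (12 * K ^ 20))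
    (hε100 : ε ≤ 1 / K ^ 100) (hKM : exp (-M) ≤ 1 / K ^ 10) (hη : η ≤ 1 / 100)
    (hδ : 0 ≤ δ) (hon : K ^ 111 ≤ exp (M * δ / 8))
    (hτ1 : 1 ≤ τ) (hfit : τ + δ + K⁻¹ ≤ T) (hT2 : T ≤ 2)
    (hεT : 64 * M * ε ^ 2 * exp (5 * M * (T - τ)) ≤ K ^ 20)
    (hcτ : ∀ t, 0 ≤ t → t ≤ τ → X t 2 ≤ ε ^ 2 / K ^ 10) (hcτeq : X τ 2 = ε ^ 2 / K ^ 10)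
    {t : ℝ} (ht : t ∈ Icc (τ + δ + K⁻¹) T) :
    (X t 0 ^ 2 + X t 1 ^ 2 + X t 2 ^ 2 + X t 3 ^ 2) / 2
        - K / 2 * (X t 0 * X t 3 * (ε ^ 2 * (X t 2)⁻¹) * X t 4)
      ≤ exp (K / 10 * ((τ + δ + K⁻¹) - t)) + 70 / K ^ 90 := by
  have hK0 : 0 < K := by linarith
  have hK1 : 1 ≤ K := by linarith
  have hu0' : 0 < K⁻¹ := inv_pos.2 hK0
  have hτT : τ ≤ T := by linarith
  have hκ : 0 < K / 10 := by positivity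
  have hI : ∀ s ∈ Icc (τ + δ + K⁻¹) T, s ∈ Icc (τ + δ) T := fun s hs =>
    ⟨by linarith [hs.1], hs.2⟩
  have ht'02 : τ + δ + K⁻¹ ∈ Icc (0:ℝ) 2 := ⟨by linarith, hfit.trans hT2⟩
  have hC0 : 0 ≤ 7 / K ^ 89 / (K / 10) := by positivity
  have hanti := antitoneOn_intFactor (s := Icc (τ + δ + K⁻¹) T)
    (f := fun s => (X s 0 ^ 2 + X s 1 ^ 2 + X s 2 ^ 2 + X s 3 ^ 2) / 2
      - K / 2 * (X s 0 * X s 3 * (ε ^ 2 * (X s 2)⁻¹) * X s 4))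
    (g := fun _ => -(K / 10)) (G := fun s => -(K / 10 * s))
    (φ := fun s => 7 / K ^ 89 * exp (K / 10 * s))
    (Φ := fun s => 7 / K ^ 89 / (K / 10) * exp (K / 10 * s))
    (convex_Icc _ T)
    (fun s hs => by
      have hsI := hI s hs
      have hs02 : s ∈ Icc (0:ℝ) 2 := ⟨by linarith [hs.1], hs.2.trans hT2⟩
      have hcl : K ^ 100 * ε ^ 2 ≤ X s 2 :=
        c_large_on hX hE h0 hε hε1 hM0 hMK hK hεK hKM hη hδ hon hτ1 hτT hT2 hεT hcτ hcτeq hsI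
      have hcne : X s 2 ≠ 0 := (lt_of_lt_of_le (by positivity) hcl).ne'
      exact hasDerivAt_Es (hX s hs02) hε.ne' hcne)
    (fun s _ => ((hasDerivAt_id s).const_mul (K / 10)).neg.congr_deriv (by simp))
    (fun s _ => by
      have hne : K / 10 ≠ 0 := hκ.ne'
      have := (((hasDerivAt_id s).const_mul (K / 10)).exp).const_mul (7 / K ^ 89 / (K / 10))
      refine this.congr_deriv ?_
      simp only [mul_one, id_eq]
      field_simp)
    (fun s hs => by
      have hdis := Es_dissipation_on hX hE h0 hε hε1 hM0 hMK hK hεK hε100 hKM hη hδ hon hτ1 hfit hT2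
        hεT hcτ hcτeq hs
      have hE' : exp (-(-(K / 10 * s))) = exp (K / 10 * s) := by rw [neg_neg]
      rw [hE']
      have h2 := mul_le_mul_of_nonneg_right hdis (exp_pos (K / 10 * s)).le
      linarith)
  have ht'mem : τ + δ + K⁻¹ ∈ Icc (τ + δ + K⁻¹) T := ⟨le_rfl, hfit⟩
  have hA := hanti ht'mem ht ht.1
  simp only [neg_neg] at hA
  have hsplit : exp (K / 10 * (τ + δ + K⁻¹))
      = exp (K / 10 * t) * exp (K / 10 * ((τ + δ + K⁻¹) - t)) := by
    rw [← exp_add]; congr 1; ring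
  rw [hsplit] at hA
  -- `E_*(t') ≤ 1`
  have hEs1 : (X (τ + δ + K⁻¹) 0 ^ 2 + X (τ + δ + K⁻¹) 1 ^ 2 + X (τ + δ + K⁻¹) 2 ^ 2
        + X (τ + δ + K⁻¹) 3 ^ 2) / 2
      - K / 2 * (X (τ + δ + K⁻¹) 0 * X (τ + δ + K⁻¹) 3 * (ε ^ 2 * (X (τ + δ + K⁻¹) 2)⁻¹)
        * X (τ + δ + K⁻¹) 4) ≤ 1 := by
    obtain ⟨-, hS1⟩ := sum_sq_sandwich hX hE h0 ht'02
    have h2 := (abs_le.1 (KVe_small_on hX hE h0 hε hε1 hM0 hMK hK hεK hKM hη hδ hon hτ1 hτT hT2 hεT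
      hcτ hcτeq (hI _ ht'mem))).1
    have h3 : 1 / 2 / K ^ 99 ≤ 1 / 2 := by
      rw [div_le_iff₀ (by positivity)]
      have : (1 : ℝ) ≤ K ^ 99 := one_le_pow₀ hK1
      linarith
    linarith [sq_nonneg (X (τ + δ + K⁻¹) 4)]
  have hρ0 : 0 < exp (K / 10 * ((τ + δ + K⁻¹) - t)) := exp_pos _
  have hEst := decay_alg (exp_pos _) hρ0 hC0 hEs1 hA
  have hCle : 7 / K ^ 89 / (K / 10) ≤ 70 / K ^ 90 := by
    rw [div_le_div_iff₀ hκ (by positivity)]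
    calc 7 / K ^ 89 * K ^ 90 = 7 * K := by field_simp
      _ ≤ 70 * (K / 10) := by linarith
  linarith

/-- **DELIVERY, (toke) ⇒ (beable) core estimate on the horizon `T`**: for a drain time `L ≥ 0` with (N4')
`2e^{-KL/10} ≤ K⁻²⁰`, `a² + b² + c² + d² ≤ 142K⁻²⁰` on `[t_c + δ + 1/K + L, T]` (`= 2E_* + KVã`).
[cite: Tao2016AveragedNS, §5.5 (beable)] -/
theorem sum_sq_on
    (hX : ∀ t ∈ Icc (0:ℝ) 2, HasDerivAt X (delayCircuitWith K M ε (X t) - E t * X t) t)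
    (hE : ∀ t ∈ Icc (0:ℝ) 2, ∀ i, 0 ≤ E t i ∧ E t i ≤ η)
    (h0 : X 0 0 ^ 2 + X 0 1 ^ 2 = 1 ∧ 0 ≤ X 0 0 ∧ -(1 / 5 * ε) ≤ X 0 1 ∧ X 0 1 ≤ 2 / 5 * ε ∧ X 0 2 = 0 ∧ X 0 3 = 0 ∧ X 0 4 = 0)
    (hε : 0 < ε) (hε1 : ε ≤ 1) (hM0 : 0 < M) (hMK : M ≤ K ^ 10) (hK : 16 ≤ K) (hεK : ε ^ 2 ≤ 1 / (12 * K ^ 20))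
    (hε100 : ε ≤ 1 / K ^ 100) (hKM : exp (-M) ≤ 1 / K ^ 10) (hη : η ≤ 1 / 100)
    (hδ : 0 ≤ δ) (hon : K ^ 111 ≤ exp (M * δ / 8))
    (hL : 0 ≤ L) (hN4 : 2 * exp (-(K / 10 * L)) ≤ 1 / K ^ 20)
    (hτ1 : 1 ≤ τ) (hfit : τ + δ + K⁻¹ + L ≤ T) (hT2 : T ≤ 2)
    (hεT : 64 * M * ε ^ 2 * exp (5 * M * (T - τ)) ≤ K ^ 20)
    (hcτ : ∀ t, 0 ≤ t → t ≤ τ → X t 2 ≤ ε ^ 2 / K ^ 10) (hcτeq : X τ 2 = ε ^ 2 / K ^ 10)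
    {t : ℝ} (ht : t ∈ Icc (τ + δ + K⁻¹ + L) T) :
    X t 0 ^ 2 + X t 1 ^ 2 + X t 2 ^ 2 + X t 3 ^ 2 ≤ 142 / K ^ 20 := by
  have hK0 : 0 < K := by linarith
  have hK1 : 1 ≤ K := by linarith
  have hu0' : 0 < K⁻¹ := inv_pos.2 hK0
  have hfit' : τ + δ + K⁻¹ ≤ T := by linarith
  have hτT : τ ≤ T := by linarith
  have ht' : t ∈ Icc (τ + δ + K⁻¹) T := ⟨by linarith [ht.1], ht.2⟩
  have htI : t ∈ Icc (τ + δ) T := ⟨by linarith [ht.1], ht.2⟩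
  have hEs := Es_decay_on hX hE h0 hε hε1 hM0 hMK hK hεK hε100 hKM hη hδ hon hτ1 hfit' hT2 hεT hcτ
    hcτeq ht'
  have hVt := (abs_le.1 (KVe_small_on hX hE h0 hε hε1 hM0 hMK hK hεK hKM hη hδ hon hτ1 hτT hT2 hεT hcτ
    hcτeq htI)).2
  have h99 : 1 / 2 / K ^ 99 ≤ 1 / 2 / K ^ 20 := by
    apply div_le_div_of_nonneg_left (by norm_num) (by positivity)
    exact pow_le_pow_right₀ hK1 (by norm_num)
  have h90 : 70 / K ^ 90 ≤ 70 / K ^ 20 := by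
    apply div_le_div_of_nonneg_left (by norm_num) (by positivity)
    exact pow_le_pow_right₀ hK1 (by norm_num)
  have hexpL : exp (K / 10 * ((τ + δ + K⁻¹) - t)) ≤ exp (-(K / 10 * L)) := by
    rw [exp_le_exp]
    have : (τ + δ + K⁻¹) - t ≤ -L := by linarith [ht.1]
    nlinarith
  have hexp20 : exp (K / 10 * ((τ + δ + K⁻¹) - t)) ≤ 1 / 2 / K ^ 20 := by
    refine hexpL.trans ?_
    have h := hN4
    rw [div_div, le_div_iff₀ (by positivity)]
    rw [le_div_iff₀ (by positivity)] at h
    linarith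
  have hw1 : (1 : ℝ) / 2 / K ^ 20 = 1 / 2 * (K ^ 20)⁻¹ := by ring
  have hw2 : (70 : ℝ) / K ^ 20 = 70 * (K ^ 20)⁻¹ := by ring
  have hw3 : (142 : ℝ) / K ^ 20 = 142 * (K ^ 20)⁻¹ := by ring
  rw [hw3]
  rw [hw1] at hexp20 h99
  rw [hw2] at h90
  linarith

/-! ## The free aftermath: `a² + b² + c² + d²` never increases -/

/-- `a² + b² + c² + d²` is non-increasing on `[0,2]` under any non-negative diagonal damping: the gates
`a ⇄ b`, `a ⇄ c`, `b ⇒ c`, `a ⇄ d` are conservative, energy leaves only through `d ⇒ ã` (`-2Kd²ã ≤ 0`, as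
`ã ≥ 0`) and the damping (`-2Σ EᵢXᵢ²`). [cite: Tao2016AveragedNS, §5.5 (energy-con)] -/
theorem sumFour_antitoneOn
    (hX : ∀ t ∈ Icc (0:ℝ) 2, HasDerivAt X (delayCircuitWith K M ε (X t) - E t * X t) t)
    (hE : ∀ t ∈ Icc (0:ℝ) 2, ∀ i, 0 ≤ E t i ∧ E t i ≤ η)
    (h0 : X 0 0 ^ 2 + X 0 1 ^ 2 = 1 ∧ 0 ≤ X 0 0 ∧ -(1 / 5 * ε) ≤ X 0 1 ∧ X 0 1 ≤ 2 / 5 * ε ∧ X 0 2 = 0 ∧ X 0 3 = 0 ∧ X 0 4 = 0)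
    (hK : 0 ≤ K) :
    AntitoneOn (fun t => X t 0 ^ 2 + X t 1 ^ 2 + X t 2 ^ 2 + X t 3 ^ 2) (Icc 0 2) := by
  have hfun : (fun t => X t 0 ^ 2 + X t 1 ^ 2 + X t 2 ^ 2 + X t 3 ^ 2)
      = fun t => X t 0 * X t 0 + X t 1 * X t 1 + X t 2 * X t 2 + X t 3 * X t 3 := by
    funext t; ring
  rw [hfun]
  have hderiv : ∀ t ∈ Icc (0:ℝ) 2,
      HasDerivAt (fun s => X s 0 * X s 0 + X s 1 * X s 1 + X s 2 * X s 2 + X s 3 * X s 3)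
        (-(2 * K * X t 3 ^ 2 * X t 4) - 2 * (E t 0 * X t 0 ^ 2 + E t 1 * X t 1 ^ 2
          + E t 2 * X t 2 ^ 2 + E t 3 * X t 3 ^ 2)) t := by
    intro t ht
    have ha := hasDerivAt_a (hX t ht)
    have hb := hasDerivAt_b (hX t ht)
    have hc := hasDerivAt_c (hX t ht)
    have hd := hasDerivAt_d (hX t ht)
    refine ((((ha.mul ha).add (hb.mul hb)).add (hc.mul hc)).add (hd.mul hd)).congr_deriv ?_
    ring
  refine antitoneOn_of_hasDerivWithinAt_nonpos (convex_Icc 0 2)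
    (fun t ht => (hderiv t ht).continuousAt.continuousWithinAt)
    (fun t ht => (hderiv t (interior_subset ht)).hasDerivWithinAt) ?_
  intro t ht
  have ht' : t ∈ Icc (0:ℝ) 2 := interior_subset ht
  have he0 : 0 ≤ X t 4 := e_nonneg hX hE h0 hK ht'
  have h0' := (hE t ht' 0).1
  have h1' := (hE t ht' 1).1
  have h2' := (hE t ht' 2).1
  have h3' := (hE t ht' 3).1
  have h1 : 0 ≤ 2 * K * X t 3 ^ 2 * X t 4 := by positivity
  have hD : 0 ≤ E t 0 * X t 0 ^ 2 + E t 1 * X t 1 ^ 2 + E t 2 * X t 2 ^ 2 + E t 3 * X t 3 ^ 2 := by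
    positivity
  linarith

/-- **Delivered energy stays delivered**: if the pulse hypothesis holds up to a horizon `T ≥ T₀`,
`T₀ = t_c + δ + 1/K + L`, then `a² + b² + c² + d² ≤ 142K⁻²⁰` on ALL of `[T₀, 2]` — at `T₀` by `sum_sq_on`,
afterwards by `sumFour_antitoneOn`; nothing is assumed about the clock after `T`.
[cite: Tao2016AveragedNS, §5.5 (beable), (energy-con)] -/
theorem sum_sq_from
    (hX : ∀ t ∈ Icc (0:ℝ) 2, HasDerivAt X (delayCircuitWith K M ε (X t) - E t * X t) t)
    (hE : ∀ t ∈ Icc (0:ℝ) 2, ∀ i, 0 ≤ E t i ∧ E t i ≤ η)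
    (h0 : X 0 0 ^ 2 + X 0 1 ^ 2 = 1 ∧ 0 ≤ X 0 0 ∧ -(1 / 5 * ε) ≤ X 0 1 ∧ X 0 1 ≤ 2 / 5 * ε ∧ X 0 2 = 0 ∧ X 0 3 = 0 ∧ X 0 4 = 0)
    (hε : 0 < ε) (hε1 : ε ≤ 1) (hM0 : 0 < M) (hMK : M ≤ K ^ 10) (hK : 16 ≤ K) (hεK : ε ^ 2 ≤ 1 / (12 * K ^ 20))
    (hε100 : ε ≤ 1 / K ^ 100) (hKM : exp (-M) ≤ 1 / K ^ 10) (hη : η ≤ 1 / 100)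
    (hδ : 0 ≤ δ) (hon : K ^ 111 ≤ exp (M * δ / 8))
    (hL : 0 ≤ L) (hN4 : 2 * exp (-(K / 10 * L)) ≤ 1 / K ^ 20)
    (hτ1 : 1 ≤ τ) (hfit : τ + δ + K⁻¹ + L ≤ T) (hT2 : T ≤ 2)
    (hεT : 64 * M * ε ^ 2 * exp (5 * M * (T - τ)) ≤ K ^ 20)
    (hcτ : ∀ t, 0 ≤ t → t ≤ τ → X t 2 ≤ ε ^ 2 / K ^ 10) (hcτeq : X τ 2 = ε ^ 2 / K ^ 10)
    {t : ℝ} (ht : t ∈ Icc (τ + δ + K⁻¹ + L) 2) :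
    X t 0 ^ 2 + X t 1 ^ 2 + X t 2 ^ 2 + X t 3 ^ 2 ≤ 142 / K ^ 20 := by
  have hK0 : 0 < K := by linarith
  have hu0' : 0 < K⁻¹ := inv_pos.2 hK0
  set T₀ : ℝ := τ + δ + K⁻¹ + L with hT₀
  have hT₀0 : 0 ≤ T₀ := by simp only [hT₀]; linarith
  have hT₀2 : T₀ ≤ 2 := hfit.trans hT2
  have hS₀ := sum_sq_on hX hE h0 hε hε1 hM0 hMK hK hεK hε100 hKM hη hδ hon hL hN4 hτ1 hfit hT2 hεT hcτ
    hcτeq (t := T₀) ⟨le_rfl, hfit⟩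
  have hmono := sumFour_antitoneOn hX hE h0 hK0.le (show T₀ ∈ Icc (0:ℝ) 2 from ⟨hT₀0, hT₀2⟩)
    (show t ∈ Icc (0:ℝ) 2 from ⟨hT₀0.trans ht.1, ht.2⟩) ht.1
  simp only at hmono
  exact hmono.trans hS₀

end HeadStart
end Summit.NavierStokesRegularity.FluidComputer
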